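import Mathlib.Analysis.SpecialFunctions.Pow.Real
import Mathlib.Analysis.SpecialFunctions.Log.Basic
import Mathlib.Analysis.SpecialFunctions.Sqrt
import Mathlib.Analysis.SpecialFunctions.Exponential
import Mathlib.Analysis.Complex.ExponentialBounds
import Mathlib.Tactic.FieldSimp
import Mathlib.Tactic.Linarith
import Mathlib.Tactic.Positivity
import Mathlib.Tactic.Ring
import HarnessLib

/-!
# The `L[1/2]` bookkeeping for the smooth-number lower bound

Pure real analysis used by `Literature/NumberTheory/Sieve/SmoothNumbersLowerBoundLHalf.lean` to
turn the combinatorial lower bound of Lenstra–Pomerance (*A rigorous time bound for factoring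
integers*, J. Amer. Math. Soc. **5** (1992), Thm 6.1; `card_factoredUpTo_ge`) into the asymptotic
statement `ψ(x, L_x[1/2, β]) ≥ x · L_x[1/2, -1/(2β) - ε]` (Canfield–Erdős–Pomerance).

Everything is expressed in the variable `s = log log x`: then `log x = e^s`,
`L = √(log x · log log x) = e^{s/2} √s`, `u = log x / log y = L / (β s)` for `y = L_x[1/2, β]`, and
`log u = s/2 - (log s)/2 - log β`. The theorem `LHalf.eventually_bookkeeping` produces an explicit
threshold `s₀(β, ε)` beyond which the four numerical conditions consumed by the main theorem hold:
`log u ≥ 4`, `√(log u) · log 16 ≤ β L`, `16 log u ≤ β L`, and the exponent estimate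
`u log (2 log u) + u log u + j log (4 β L / √(log u)) + j log j + β L / √(log u) ≤ (1/(2β) + ε) L`
for `0 ≤ j ≤ 2 (u / log u + 1) √(log u) + 1`.

Elementary inequalities only (`log t ≤ t/a - 1 + log a`, `1 + t + t²/2 ≤ e^t`); no limits are taken. The
quantities `lu, L, u` are passed to the auxiliary lemmas as real variables together with their
defining (in)equalities, so that no auxiliary definitions are introduced.

## References

* H. W. Lenstra Jr., C. Pomerance, J. Amer. Math. Soc. 5 (1992) 483–516, §6 (proof of Thm 6.1,
  the estimates (6.5), (6.7)–(6.9) and "It remains to estimate w"). [LenstraPomerance1992]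
-/

namespace Literature.NumberTheory.Sieve

namespace LHalf

/-! ### Elementary inequalities -/

/-- `log t ≤ t / a - 1 + log a` for `0 < t`, `0 < a` (tangent-line bound at `t = a`). [folklore] -/
theorem log_le_div_sub_one_add_log {t a : ℝ} (ht : 0 < t) (ha : 0 < a) :
    Real.log t ≤ t / a - 1 + Real.log a := by
  have h := Real.log_le_sub_one_of_pos (div_pos ht ha)
  have : Real.log t = Real.log (t / a) + Real.log a := by
    rw [← Real.log_mul (div_pos ht ha).ne' ha.ne', div_mul_cancel₀ _ ha.ne']
  linarith

/-- `t ^ 2 / 16 ≤ exp (t / 2)` for `0 ≤ t`. [folklore] -/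
theorem sq_div_le_exp_half {t : ℝ} (ht : 0 ≤ t) : t ^ 2 / 16 ≤ Real.exp (t / 2) := by
  have h := Real.add_one_le_exp (t / 4)
  have h4 : 0 ≤ t / 4 + 1 := by linarith
  have : Real.exp (t / 2) = Real.exp (t / 4) ^ 2 := by
    rw [← Real.exp_nat_mul]; ring_nf
  rw [this]
  nlinarith [pow_le_pow_left₀ h4 h 2]

/-- `3 t ≤ exp t` for `4 ≤ t`. [folklore] -/
theorem three_mul_le_exp {t : ℝ} (ht : 4 ≤ t) : 3 * t ≤ Real.exp t := by
  have h := Real.quadratic_le_exp_of_nonneg (show 0 ≤ t by linarith)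
  nlinarith

/-- `j log j ≤ M log M` for `0 ≤ j ≤ M`, `1 ≤ M`. [folklore] -/
theorem mul_log_le_mul_log {j M : ℝ} (hj : 0 ≤ j) (hjM : j ≤ M) (hM : 1 ≤ M) :
    j * Real.log j ≤ M * Real.log M := by
  have hM0 : 0 ≤ M * Real.log M := mul_nonneg (by linarith) (Real.log_nonneg hM)
  rcases le_or_gt j 1 with hj1 | hj1
  · exact (mul_nonpos_of_nonneg_of_nonpos hj (Real.log_nonpos hj hj1)).trans hM0
  · exact mul_le_mul hjM (Real.log_le_log (by linarith) hjM) (Real.log_nonneg hj1.le)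
      (by linarith)

/-- `log 16 ≤ 45/16` and `1 ≤ log 16`. [folklore] -/
theorem log_sixteen_bounds : 1 ≤ Real.log 16 ∧ Real.log 16 ≤ 45 / 16 := by
  rw [show (16 : ℝ) = 2 ^ 4 by norm_num, Real.log_pow]
  push_cast
  constructor <;> linarith [Real.log_two_lt_d9, Real.log_two_gt_d9]

/-! ### The quantities `lu = log u`, `L`, `u` as functions of `s = log log x` -/

/-- `s/4 - |log β| ≤ lu ≤ s/2 + |log β|` for `lu = s/2 - (log s)/2 - log β`, `s ≥ 1`. [folklore] -/
theorem lu_bounds {β s lu : ℝ} (hs : 1 ≤ s) (hlu : lu = s / 2 - Real.log s / 2 - Real.log β) :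
    s / 4 - |Real.log β| ≤ lu ∧ lu ≤ s / 2 + |Real.log β| := by
  have h0 : 0 ≤ Real.log s := Real.log_nonneg hs
  have h1 : Real.log s ≤ s / 2 := by
    linarith [log_le_div_sub_one_add_log (show (0 : ℝ) < s by linarith) two_pos,
      Real.log_two_lt_d9]
  have h2 := le_abs_self (Real.log β)
  have h3 := neg_abs_le (Real.log β)
  constructor <;> rw [hlu] <;> linarith

/-- `log u = lu` for `u = e^{s/2} √s / (β s)`. [folklore] -/
theorem log_u_eq {β s : ℝ} (hβ : 0 < β) (hs : 0 < s) :
    Real.log (Real.exp (s / 2) * Real.sqrt s / (β * s)) = s / 2 - Real.log s / 2 - Real.log β := by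
  have hsq : 0 < Real.sqrt s := Real.sqrt_pos.2 hs
  rw [Real.log_div (by positivity) (by positivity), Real.log_mul (by positivity) hsq.ne',
    Real.log_exp, Real.log_sqrt hs.le, Real.log_mul hβ.ne' hs.ne']
  ring

/-- `β s² √s / 16 ≤ β L` for `L = e^{s/2} √s`. [folklore] -/
theorem betaL_lower {β s : ℝ} (hβ : 0 < β) (hs : 0 < s) :
    β * s ^ 2 * Real.sqrt s / 16 ≤ β * (Real.exp (s / 2) * Real.sqrt s) := by
  have h := sq_div_le_exp_half hs.le
  have hsq : 0 ≤ Real.sqrt s := Real.sqrt_nonneg s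
  have : β * s ^ 2 * Real.sqrt s / 16 = β * (s ^ 2 / 16 * Real.sqrt s) := by ring
  rw [this]
  exact mul_le_mul_of_nonneg_left (mul_le_mul_of_nonneg_right h hsq) hβ.le

/-- (o2)/(o3): `√lu · log 16 ≤ β L` and `16 lu ≤ β L` once `s ≥ 301/β`, `lu ≤ s`, `1 ≤ s`.
[folklore] -/
theorem o2_o3 {β s lu L : ℝ} (hβ : 0 < β) (hs1 : 1 ≤ s) (hsβ : 301 / β ≤ s)
    (hlus : lu ≤ s) (hL : L = Real.exp (s / 2) * Real.sqrt s) :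
    Real.sqrt lu * Real.log 16 ≤ β * L ∧ 16 * lu ≤ β * L := by
  have hs0 : 0 < s := by linarith
  have hsqs : 0 < Real.sqrt s := Real.sqrt_pos.2 hs0
  have hsq1 : 1 ≤ Real.sqrt s := by rw [Real.one_le_sqrt]; exact hs1
  have hLlow := betaL_lower hβ hs0
  rw [← hL] at hLlow
  have h301 : 301 ≤ β * s := by rwa [div_le_iff₀' hβ] at hsβ
  have hs2 : β * s ≤ β * s ^ 2 := by nlinarith
  obtain ⟨h16l, h16⟩ := log_sixteen_bounds
  constructor
  · have h1 : Real.sqrt lu * Real.log 16 ≤ Real.sqrt s * (45 / 16) :=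
      mul_le_mul (Real.sqrt_le_sqrt hlus) h16 (by linarith) hsqs.le
    have h3 : Real.sqrt s * (45 / 16) ≤ β * s ^ 2 * Real.sqrt s / 16 := by nlinarith
    linarith
  · have h3 : 16 * s ≤ β * s ^ 2 * Real.sqrt s / 16 := by
      have : β * s ^ 2 ≤ β * s ^ 2 * Real.sqrt s := by nlinarith
      nlinarith
    linarith

/-- `u lu ≤ (1/(2β)) L + (ε/4) L` once `s ≥ 4|log β|/(βε)` (`u = L/(βs)`, `lu ≤ s/2 + |log β|`).
[folklore] -/
theorem term_main {β ε s lu L u : ℝ} (hβ : 0 < β) (hε : 0 < ε) (hs0 : 0 < s) (hL0 : 0 < L)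
    (hu : u = L / (β * s)) (hlu : lu ≤ s / 2 + |Real.log β|) (hsC : 4 * |Real.log β| / (β * ε) ≤ s) :
    u * lu ≤ (1 / (2 * β)) * L + (ε / 4) * L := by
  have hu0 : 0 < u := by rw [hu]; positivity
  have h1 : u * lu ≤ u * (s / 2 + |Real.log β|) := mul_le_mul_of_nonneg_left hlu hu0.le
  have h2 : u * (s / 2 + |Real.log β|) = (1 / (2 * β)) * L + (|Real.log β| / (β * s)) * L := by
    rw [hu]; field_simp
  have h3 : |Real.log β| / (β * s) ≤ ε / 4 := by
    rw [div_le_iff₀ (by positivity)]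
    rw [div_le_iff₀ (by positivity)] at hsC
    linarith
  have h4 : (|Real.log β| / (β * s)) * L ≤ (ε / 4) * L := mul_le_mul_of_nonneg_right h3 hL0.le
  linarith

/-- `u log (2 lu) ≤ (ε/4) L` once `s ≥ 2|log β| + 2a|log a| + 2a` with `a = 8/(βε)`. [folklore] -/
theorem term_loglog {β ε s lu L u : ℝ} (hβ : 0 < β) (hε : 0 < ε) (hs0 : 0 < s)
    (hu : u = L / (β * s)) (hL0 : 0 < L) (hlu4 : 4 ≤ lu) (hlu : lu ≤ s / 2 + |Real.log β|)
    (hsE : 2 * |Real.log β| + 2 * (8 / (β * ε)) * |Real.log (8 / (β * ε))| + 2 * (8 / (β * ε)) ≤ s) :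
    u * Real.log (2 * lu) ≤ (ε / 4) * L := by
  set a : ℝ := 8 / (β * ε) with ha_def
  set B : ℝ := |Real.log β| with hB
  have ha : 0 < a := by positivity
  have hu0 : 0 < u := by rw [hu]; positivity
  have h1 : Real.log (2 * lu) ≤ Real.log (s + 2 * B) :=
    Real.log_le_log (by linarith) (by linarith)
  have h2 : Real.log (s + 2 * B) ≤ (s + 2 * B) / a - 1 + Real.log a :=
    log_le_div_sub_one_add_log (by linarith [abs_nonneg (Real.log β)]) ha
  have h3 : (s + 2 * B) / a - 1 + Real.log a ≤ 2 * s / a := by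
    have hla := le_abs_self (Real.log a)
    have key : s + 2 * B + a * Real.log a ≤ 2 * s := by nlinarith [abs_nonneg (Real.log a)]
    have e1 : (s + 2 * B) / a - 1 + Real.log a = (s + 2 * B - a + a * Real.log a) / a := by
      field_simp
    rw [e1, div_le_div_iff_of_pos_right ha]
    linarith
  have h4 : 2 * s / a = (β * ε / 4) * s := by rw [ha_def]; field_simp; ring
  have h5 : Real.log (2 * lu) ≤ (β * ε / 4) * s := by linarith
  calc u * Real.log (2 * lu) ≤ u * ((β * ε / 4) * s) := mul_le_mul_of_nonneg_left h5 hu0.le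
    _ = (ε / 4) * L := by rw [hu]; field_simp

/-- `j ≤ 3u/√lu` and `1 ≤ 3u/√lu` for `0 ≤ j ≤ 2(u/lu + 1)√lu + 1`, `u = e^{lu}`, `lu ≥ 4`. [folklore] -/
theorem j_le {j u lu : ℝ} (hlu4 : 4 ≤ lu) (hu : u = Real.exp lu)
    (hjle : j ≤ 2 * (u / lu + 1) * Real.sqrt lu + 1) :
    j ≤ 3 * u / Real.sqrt lu ∧ 1 ≤ 3 * u / Real.sqrt lu := by
  have hlu0 : 0 < lu := by linarith
  have hsq0 : 0 < Real.sqrt lu := Real.sqrt_pos.2 hlu0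
  have hsq : Real.sqrt lu * Real.sqrt lu = lu := Real.mul_self_sqrt hlu0.le
  have hsq1 : 1 ≤ Real.sqrt lu := by rw [Real.one_le_sqrt]; linarith
  have hu3 : 3 * lu ≤ u := by rw [hu]; exact three_mul_le_exp hlu4
  have hu0 : 0 < u := by linarith
  constructor
  · have h1 : 2 * (u / lu + 1) * Real.sqrt lu = 2 * u / Real.sqrt lu + 2 * Real.sqrt lu := by
      field_simp
      nlinarith [hsq]
    have h2 : 2 * Real.sqrt lu + 1 ≤ u / Real.sqrt lu := by
      rw [le_div_iff₀ hsq0]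
      have : Real.sqrt lu ≤ lu := by nlinarith
      nlinarith [hsq]
    have h3 : 2 * u / Real.sqrt lu + u / Real.sqrt lu = 3 * u / Real.sqrt lu := by ring
    linarith
  · rw [le_div_iff₀ hsq0]
    have : Real.sqrt lu ≤ lu := by nlinarith
    linarith

/-- `j log j ≤ 6 u √lu` under the same hypotheses. [folklore] -/
theorem term_jlogj {j u lu : ℝ} (hj0 : 0 ≤ j) (hlu4 : 4 ≤ lu) (hu : u = Real.exp lu)
    (hjle : j ≤ 2 * (u / lu + 1) * Real.sqrt lu + 1) :
    j * Real.log j ≤ 6 * u * Real.sqrt lu := by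
  have hlu0 : 0 < lu := by linarith
  have hsq0 : 0 < Real.sqrt lu := Real.sqrt_pos.2 hlu0
  have hsq : Real.sqrt lu * Real.sqrt lu = lu := Real.mul_self_sqrt hlu0.le
  have hsq1 : 1 ≤ Real.sqrt lu := by rw [Real.one_le_sqrt]; linarith
  obtain ⟨hjM, hM1⟩ := j_le hlu4 hu hjle
  have hu0 : 0 < u := by rw [hu]; exact Real.exp_pos _
  have hlogu : Real.log u = lu := by rw [hu, Real.log_exp]
  have hlog3 : Real.log 3 ≤ lu := by
    linarith [log_le_div_sub_one_add_log (show (0 : ℝ) < 3 by norm_num) two_pos,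
      Real.log_two_lt_d9]
  have h1 := mul_log_le_mul_log hj0 hjM hM1
  have h2 : Real.log (3 * u / Real.sqrt lu) ≤ 2 * lu := by
    have : Real.log (3 * u / Real.sqrt lu) ≤ Real.log (3 * u) := by
      apply Real.log_le_log (by positivity)
      rw [div_le_iff₀ hsq0]
      nlinarith
    rw [Real.log_mul (by norm_num) hu0.ne', hlogu] at this
    linarith
  have h3 : 3 * u / Real.sqrt lu * Real.log (3 * u / Real.sqrt lu) ≤
      3 * u / Real.sqrt lu * (2 * lu) := mul_le_mul_of_nonneg_left h2 (by positivity)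
  have h4 : 3 * u / Real.sqrt lu * (2 * lu) = 6 * u * Real.sqrt lu := by
    field_simp
    nlinarith [hsq]
  linarith

/-- `j log (4 β L/√lu) ≤ 6 u √lu` once `s ≥ 40 + 24|log β|`, `√lu ≤ β L`, `lu ≥ 4`, `u = e^{lu}`,
`lu = s/2 - (log s)/2 - log β`, `L = e^{s/2} √s`. [folklore] -/
theorem term_jlogW {β s j u lu L : ℝ} (hβ : 0 < β) (hs0 : 0 < s) (hlu4 : 4 ≤ lu)
    (hu : u = Real.exp lu) (hlu : lu = s / 2 - Real.log s / 2 - Real.log β)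
    (hL : L = Real.exp (s / 2) * Real.sqrt s) (hsqL : Real.sqrt lu ≤ β * L)
    (hjle : j ≤ 2 * (u / lu + 1) * Real.sqrt lu + 1) (hsD : 40 + 24 * |Real.log β| ≤ s) :
    j * Real.log (4 * (β * L / Real.sqrt lu)) ≤ 6 * u * Real.sqrt lu := by
  have hlu0 : 0 < lu := by linarith
  have hsq0 : 0 < Real.sqrt lu := Real.sqrt_pos.2 hlu0
  have hsq : Real.sqrt lu * Real.sqrt lu = lu := Real.mul_self_sqrt hlu0.le
  have hsq1 : 1 ≤ Real.sqrt lu := by rw [Real.one_le_sqrt]; linarith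
  have hsqs : 0 < Real.sqrt s := Real.sqrt_pos.2 hs0
  have hL0 : 0 < L := by rw [hL]; positivity
  obtain ⟨hjM, -⟩ := j_le hlu4 hu hjle
  have hu0 : 0 < u := by rw [hu]; exact Real.exp_pos _
  have hpos : 1 ≤ 4 * (β * L / Real.sqrt lu) := by
    rw [mul_div_assoc', le_div_iff₀ hsq0]
    nlinarith
  have h1 : Real.log (4 * (β * L / Real.sqrt lu)) ≤ Real.log (4 * (β * L)) := by
    apply Real.log_le_log (by positivity)
    exact mul_le_mul_of_nonneg_left (div_le_self (by positivity) hsq1) (by norm_num)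
  have h2 : Real.log (4 * (β * L)) = Real.log 4 + Real.log β + s / 2 + Real.log s / 2 := by
    rw [hL, Real.log_mul (by norm_num) (by positivity), Real.log_mul hβ.ne' (by positivity),
      Real.log_mul (by positivity) hsqs.ne', Real.log_exp, Real.log_sqrt hs0.le]
    ring
  have hlog4 : Real.log 4 ≤ 7 / 5 := by
    rw [show (4 : ℝ) = 2 ^ 2 by norm_num, Real.log_pow]
    push_cast
    linarith [Real.log_two_lt_d9]
  have hlog8 : Real.log 8 ≤ 21 / 10 := by
    rw [show (8 : ℝ) = 2 ^ 3 by norm_num, Real.log_pow]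
    push_cast
    linarith [Real.log_two_lt_d9]
  have hlogs8 : Real.log s ≤ s / 8 - 1 + Real.log 8 := log_le_div_sub_one_add_log hs0 (by norm_num)
  have hB := le_abs_self (Real.log β)
  have hB' := neg_abs_le (Real.log β)
  have h3 : Real.log (4 * (β * L)) ≤ 2 * lu := by
    rw [h2, hlu]
    linarith
  have h4 : Real.log (4 * (β * L / Real.sqrt lu)) ≤ 2 * lu := h1.trans h3
  have h5 : 0 ≤ Real.log (4 * (β * L / Real.sqrt lu)) := Real.log_nonneg hpos
  calc j * Real.log (4 * (β * L / Real.sqrt lu)) ≤ 3 * u / Real.sqrt lu * (2 * lu) :=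
        mul_le_mul hjM h4 h5 (by positivity)
    _ = 6 * u * Real.sqrt lu := by
        field_simp
        nlinarith [hsq]

/-- `12 u √lu ≤ (ε/4) L` once `s ≥ (48/(βε))²`, `lu ≤ s`, `u = L/(βs)`. [folklore] -/
theorem term_twelve {β ε s lu L u : ℝ} (hβ : 0 < β) (hε : 0 < ε) (hs0 : 0 < s) (hL0 : 0 < L)
    (hu : u = L / (β * s)) (hlus : lu ≤ s) (hsA : (48 / (β * ε)) ^ 2 ≤ s) :
    12 * u * Real.sqrt lu ≤ (ε / 4) * L := by
  have hsqs : 0 < Real.sqrt s := Real.sqrt_pos.2 hs0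
  have hsq : Real.sqrt s * Real.sqrt s = s := Real.mul_self_sqrt hs0.le
  have hu0 : 0 < u := by rw [hu]; positivity
  have h1 : 12 * u * Real.sqrt lu ≤ 12 * u * Real.sqrt s :=
    mul_le_mul_of_nonneg_left (Real.sqrt_le_sqrt hlus) (by positivity)
  have h2 : 12 * u * Real.sqrt s = (12 / (β * Real.sqrt s)) * L := by
    rw [hu]
    field_simp
    nlinarith [hsq]
  have h3 : 12 / (β * Real.sqrt s) ≤ ε / 4 := by
    rw [div_le_div_iff₀ (by positivity) (by norm_num)]
    have h5 : 48 / (β * ε) ≤ Real.sqrt s := by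
      rw [← Real.sqrt_sq (show (0 : ℝ) ≤ 48 / (β * ε) by positivity)]
      exact Real.sqrt_le_sqrt hsA
    rw [div_le_iff₀ (by positivity)] at h5
    nlinarith
  calc 12 * u * Real.sqrt lu ≤ (12 / (β * Real.sqrt s)) * L := by linarith
    _ ≤ (ε / 4) * L := mul_le_mul_of_nonneg_right h3 hL0.le

/-- `β L/√lu ≤ (ε/4) L` once `lu ≥ 16β²/ε²`. [folklore] -/
theorem term_logW {β ε lu L : ℝ} (hβ : 0 < β) (hε : 0 < ε) (hL0 : 0 < L)
    (hlu : 16 * β ^ 2 / ε ^ 2 ≤ lu) : β * L / Real.sqrt lu ≤ (ε / 4) * L := by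
  have hlu0 : 0 < lu := lt_of_lt_of_le (by positivity) hlu
  have hsq0 : 0 < Real.sqrt lu := Real.sqrt_pos.2 hlu0
  rw [div_le_iff₀ hsq0]
  have h2 : 4 * β / ε ≤ Real.sqrt lu := by
    rw [← Real.sqrt_sq (show (0 : ℝ) ≤ 4 * β / ε by positivity)]
    refine Real.sqrt_le_sqrt (le_trans (le_of_eq ?_) hlu)
    field_simp
    ring
  rw [div_le_iff₀ hε] at h2
  nlinarith

/-! ### The threshold -/

/-- **The `L[1/2]` bookkeeping.** For `β, ε > 0` there is `s₀ ≥ 1` such that for all `s ≥ s₀`,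
with `lu = s/2 - (log s)/2 - log β` (`= log u`), `L = e^{s/2} √s` and `u = L / (β s)`:
`4 ≤ lu`, `√lu · log 16 ≤ β L`, `16 lu ≤ β L`, and for every real `0 ≤ j ≤ 2 (u/lu + 1) √lu + 1`,
`u log (2 lu) + u lu + j log (4 β L / √lu) + j log j + β L / √lu ≤ (1/(2β) + ε) L`.
These are exactly the largeness conditions under which the parameter choice `k = ⌊u⌋`,
`v = y^{1 - 1/log u}`, `w = y^{(log u)^{-1/2}}`, `J = ⌈2 (u / log u + 1) √(log u)⌉` in
Lenstra–Pomerance's Theorem 6.1 yields `ψ(x, L_x[1/2, β]) ≥ x L_x[1/2, -1/(2β) - ε]`.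
[cite: LenstraPomerance1992, §6 proof of Thm 6.1 (6.5)–(6.11)] -/
theorem eventually_bookkeeping {β ε : ℝ} (hβ : 0 < β) (hε : 0 < ε) :
    ∃ s₀ : ℝ, 1 ≤ s₀ ∧ ∀ s : ℝ, s₀ ≤ s →
      ∀ lu L u : ℝ, lu = s / 2 - Real.log s / 2 - Real.log β →
        L = Real.exp (s / 2) * Real.sqrt s → u = L / (β * s) →
      4 ≤ lu ∧ Real.sqrt lu * Real.log 16 ≤ β * L ∧ 16 * lu ≤ β * L ∧
        ∀ j : ℝ, 0 ≤ j → j ≤ 2 * (u / lu + 1) * Real.sqrt lu + 1 →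
          u * Real.log (2 * lu) + u * lu + j * Real.log (4 * (β * L / Real.sqrt lu)) +
              j * Real.log j + β * L / Real.sqrt lu ≤ (1 / (2 * β) + ε) * L := by
  set B : ℝ := |Real.log β| with hB
  set a : ℝ := 8 / (β * ε) with ha_def
  -- the threshold: a sum of nonnegative requirements (each summand dominates one condition)
  set s₀ : ℝ := 1 + 4 * (4 + B + 16 * β ^ 2 / ε ^ 2) + (48 / (β * ε)) ^ 2 + 301 / β +
    4 * B / (β * ε) + (40 + 24 * B) + (2 * B + 2 * a * |Real.log a| + 2 * a) with hs₀
  have hBnn : 0 ≤ B := abs_nonneg _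
  have ha : 0 < a := by positivity
  have t1 : 0 ≤ 4 * (4 + B + 16 * β ^ 2 / ε ^ 2) := by positivity
  have t2 : 0 ≤ (48 / (β * ε)) ^ 2 := by positivity
  have t3 : 0 ≤ 301 / β := by positivity
  have t4 : 0 ≤ 4 * B / (β * ε) := by positivity
  have t5 : 0 ≤ 40 + 24 * B := by positivity
  have t6 : 0 ≤ 2 * B + 2 * a * |Real.log a| + 2 * a := by positivity
  refine ⟨s₀, by linarith, fun s hs lu L u hlu hL hu => ?_⟩
  have hs1 : 1 ≤ s := by linarith
  have hs0 : 0 < s := by linarith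
  obtain ⟨hlu_lo, hlu_hi⟩ := lu_bounds hs1 hlu
  have hlu4 : 4 ≤ lu := by
    have : 4 * (4 + B + 16 * β ^ 2 / ε ^ 2) ≤ s := by linarith
    have h16 : 0 ≤ 16 * β ^ 2 / ε ^ 2 := by positivity
    linarith
  have hlu16 : 16 * β ^ 2 / ε ^ 2 ≤ lu := by
    have : 4 * (4 + B + 16 * β ^ 2 / ε ^ 2) ≤ s := by linarith
    linarith
  have hlus : lu ≤ s := by
    have h0 : 0 ≤ Real.log s := Real.log_nonneg hs1
    rw [hlu]; linarith [le_abs_self (Real.log β), neg_abs_le (Real.log β)]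
  have hL0 : 0 < L := by rw [hL]; positivity
  obtain ⟨ho2, ho3⟩ := o2_o3 hβ hs1 (by linarith) hlus hL
  refine ⟨hlu4, ho2, ho3, fun j hj0 hjle => ?_⟩
  have hu_exp : u = Real.exp lu := by
    have hu0 : 0 < u := by rw [hu]; positivity
    rw [← Real.exp_log hu0, hu, hL, log_u_eq hβ hs0, ← hlu]
  have hsqL : Real.sqrt lu ≤ β * L := by
    obtain ⟨h1, -⟩ := log_sixteen_bounds
    have : Real.sqrt lu ≤ Real.sqrt lu * Real.log 16 := by
      have := Real.sqrt_nonneg lu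
      nlinarith
    linarith
  have hT1 := term_main hβ hε hs0 hL0 hu hlu_hi (by linarith)
  have hT2 := term_loglog hβ hε hs0 hu hL0 hlu4 hlu_hi (by linarith)
  have hT3 := term_jlogj hj0 hlu4 hu_exp hjle
  have hT4 := term_jlogW hβ hs0 hlu4 hu_exp hlu hL hsqL hjle (by linarith)
  have hT34 := term_twelve hβ hε hs0 hL0 hu hlus (by linarith)
  have hT5 := term_logW hβ hε hL0 hlu16
  linarith

end LHalf

end Literature.NumberTheory.Sieve
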